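import Summits.QuantumFields.BalabanUV.T4Continuum.Support.RegionGradientTwoScale
import Summits.QuantumFields.BalabanUV.T4Continuum.Support.RegionGaugeTwoZoneTransfer
import Summits.QuantumFields.BalabanUV.T4Continuum.Support.RegionGaugeFixedVectorFlat

/-!
# `BalabanUV.T4Continuum.Support.RegionGaugeOrbit` — NE2 (node U1a) formalisation swarm, SUPPLIER item «Δ1-COERC-ORTH-LINE» under the
# owner's sub-row `T4-U1a.S-NE2-D1-DIRICHLET°` (vector layer, W1): THE DISPLAYED W1 INEQUALITY IN ORBIT FORM — «every star-bond field lies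
# within `√(C₁‖curl A‖² + C₂ n^d‖QA‖²)` of SOME Dirichlet pure gauge `∂_Ω μ` (μ ANY scalar on Ω, no zero-mean condition)» IMPLIES
# `OrthSliceCoercive` with an explicit constant, and conversely (unit b2b-balaban-t4-ne2-formalise-leaf-09, gen 9, v1)

HONEST FRAMING (T4-DAG p. 1).  [folklore] `U = 1` lattice bookkeeping on ONE region (any decidable set `S` of unit blocks), finite torus,
`2 ≤ n`; a REDUCTION — neither the orbit inequality nor `OrthSliceCoercive` is proved here for any `S ≠ ⊤` (the cylinder ∕ single-block
instances are the business of the sequel files `RegionStarLineGauge*`); nothing printed is a hypothesis; NE2 (U1a) NOT proved; spine PROVED 0/9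
unchanged; NOT [B9] (3.23)–(3.27) as printed; NOT infinite volume, NOT the mass gap, NOT Clay.  HONEST DEPENDENCY (verbatim): «continuum YM
on T⁴ ⇐ BetaPertH ∧ nine spine estimates (0/9 proved); BetaPertH ⇐ (D1) ∧ (D4) ∧ CAP+tail; G-an2-4 gates asym, D1 and NE2/3/4.»

WHY.  Gen 8 (`RegionGaugeSliceOrth(Region)`) traded Bałaban's slice `{R(Ω₀)·∂_Ω*A = 0}` for the ℓ²-orthogonal slice `{A ⊥ ∂_Ω N(Q′_Ω)}`:
the located open estimate W1 of the vector layer (memo `t4/T4-EST-NE2-D1-COERC.md` §6, `…-ORTH.md` §2) reads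
`OrthSliceCoercive (curlR n M S) (gradR n M S) (QOm n M S) (avgR n M S) (a·n^d) c`.  A field on the orthogonal slice is the SMALLEST point of its
residual orbit `A + ∂_Ω N(Q′_Ω)` (Pythagoras), so W1 says: `c·dist²(A, ∂_Ω N(Q′_Ω)) ≤ ‖curl A‖² + a n^d‖QA‖²` for EVERY `A`.  Any constructive
gauge (axial ∕ line ∕ patch gauges — routes (r4-a)/(r4-b) of the lineage memo) produces a Dirichlet scalar `μ` on `Ω` with `A − ∂_Ω μ` small,
but NOT one with zero block means.  THIS FILE removes that constraint once and for all:

 * §1 `nsq_avgR_le`: `n^d·nsq (avgR A) ≤ nsq A` on the star bonds (leaf-07's `nsq_QvOp_mulVec_le` through the zero-extension).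
 * §2 THE `N(Q′)`-CORRECTION `zeroMean μ := μ − E(Q′_Ω μ)` by gen 8's two-scale extension operator `E = blockExt` (`Q′_Ω E g = g`,
   `nsq (∂_Ω E g) ≤ Cext·n^d·nsq (∇₁ g)`): `QOm (zeroMean μ) = 0`, and — since `∇₁(Q′_Ω μ) = Q(∂_Ω μ) = QA − Q(A − ∂_Ω μ)` («Q∂ = ∂₁Q′»,
   leaf-07-g5's `avgR_mul_gradR`) — **`nsq_sub_gradR_zeroMean_le`**:
   `nsq (A − ∂_Ω zeroMean μ) ≤ (2 + 4·Cext)·nsq (A − ∂_Ω μ) + 4·Cext·n^d·nsq (avgR A)`.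
 * §3 ORBIT MINIMALITY `nsq_le_of_orth_ker` (a field orthogonal to `∂_Ω N(Q′_Ω)` is no longer than any point of its residual orbit) and the
   per-field END **`nsq_le_of_gauge`**: for `A ⊥ ∂_Ω N(Q′_Ω)` and ANY `μ`, `nsq A ≤ (2 + 4·Cext)·nsq (A − ∂_Ω μ) + 4·Cext·n^d·nsq (avgR A)`.
 * §4 THE END **`orthSlice_of_gaugePoincare`**: if `∀ A, ∃ μ, nsq (A − ∂_Ω μ) ≤ C₁·nsq (curlR A) + C₂·n^d·nsq (avgR A)` (`0 ≤ C₂`, `0 < a`,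
   `2 ≤ n`) then `OrthSliceCoercive (curlR …) (gradR …) (QOm …) (avgR …) (a·n^d) (orbitConst d a C₁ C₂)`,
   `orbitConst = (max ((2+4Cext)C₁) (((2+4Cext)C₂ + 4Cext)/a))⁻¹ > 0` — uniform in whatever `C₁`, `C₂` are uniform in; and §5 the converse
   **`gaugePoincare_of_orthSlice`** (μ = gen 8's `orthGauge`, which even lies in `N(Q′_Ω)`): W1 ⟺ the orbit inequality, up to constants.

ABSOLUTE RULE (cell, verbatim): «No internally-minted statement may enter as a cited fact. Every hypothesis is either kernel-proved in
this package or a verbatim quotation of a PUBLISHED theorem with page reference. The manuscript(s) under audit are NOT citable for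
their own disputed steps — they are the thing under adjudication; programme-internal (2001/route/tribunal) claims are never citable.»
[folklore] throughout; parametrised shape predicates only (`OrthSliceCoercive`); no `def … : Prop` fact; one real constant `orbitConst` and one
data def `zeroMean`.  NOT CLAIMED: the orbit inequality or W1 for any `S ≠ ⊤`; NE2; NE3; «not in print; our reduction».
-/

noncomputable section

open scoped BigOperators ComplexConjugate Matrix

namespace Summit.QuantumFields.BalabanUV.T4Continuum.RegionGaugeOrbit

open Literature.MathematicalPhysics.QuantumFieldTheory.Balaban1983to89.B5Prop11Plancherel (Tor fine unitVec)
open Literature.MathematicalPhysics.QuantumFieldTheory.Balaban1983to89.B5Prop11Lower (nsq nsq_nonneg)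
open Summit.QuantumFields.BalabanUV.T4Continuum
open Summit.QuantumFields.BalabanUV.T4Continuum.SubtypeCompression (ext nsq_ext)
open Summit.QuantumFields.BalabanUV.T4Continuum.ScalarBlockPoincare (nsq_add_le nsq_sub_comm)
open Summit.QuantumFields.BalabanUV.T4Continuum.ScalarAveragedCompression (sigma0 sigma0_pos)
open Summit.QuantumFields.BalabanUV.T4Continuum.RegionScalarCompression (QOm GOm)
open Summit.QuantumFields.BalabanUV.T4Continuum.RegionGaugeFixedVector (starReg curlR gradR avgR grad₁R avgR_mul_gradR sliceData_region)
open Summit.QuantumFields.BalabanUV.T4Continuum.RegionGaugeFixedVectorFlat (avgR_mulVec)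
open Summit.QuantumFields.BalabanUV.T4Continuum.RegionGaugeSliceOrth (OrthSliceCoercive nsq_add_of_orth orthGauge orthPart Qs_orthGauge
  orth_orthPart Cu_orthPart Qv_orthPart isUnit_det_gramS)
open Summit.QuantumFields.BalabanUV.T4Continuum.RegionGaugeSliceOrthRegion (QOm_mul_conjTranspose coercive_GOm_const)
open Summit.QuantumFields.BalabanUV.T4Continuum.RegionBlockExtension (blockExt QOm_blockExt Cext)
open Summit.QuantumFields.BalabanUV.T4Continuum.RegionGradientTwoScale (nsq_gradR_blockExt_le Cext_pos)
open Summit.QuantumFields.BalabanUV.T4Continuum.RegionGaugeTwoZoneTransfer (nsq_QvOp_mulVec_le)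
open Summit.QuantumFields.BalabanUV.Beta.GAN24.DirichletBoxTrace (blockReg)

variable {d : ℕ} (n : ℕ) [NeZero n] (M : Fin d → ℕ) [hM : ∀ μ, NeZero (M μ)] (a a' : ℝ) (S : Tor M → Prop) [DecidablePred S]

/-! ## §1 The vector block averaging contracts on the star bonds -/

/-- **`n^d·nsq (avgR A) ≤ nsq A`**: Bałaban's vector averaging read on the star bonds is `n^{−d/2}`-bounded (leaf-07's `nsq_QvOp_mulVec_le`
applied to the zero-extension). [cite: Balaban1984PropagatorsI, (1.18) p.20 (shape)] [folklore] -/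
theorem nsq_avgR_le (v : {b // starReg n M S b} → ℂ) : (n : ℝ) ^ d * nsq (avgR n M S *ᵥ v) ≤ nsq v := by
  rw [avgR_mulVec, ← nsq_ext (starReg n M S) v]
  exact nsq_QvOp_mulVec_le n M _

/-- `nsq (−f) = nsq f`. [folklore] -/
theorem nsq_neg' {ι : Type*} [Fintype ι] (f : ι → ℂ) : nsq (-f) = nsq f := by
  unfold nsq; simp only [Pi.neg_apply, norm_neg]

/-! ## §2 The `N(Q′_Ω)`-correction of an arbitrary Dirichlet gauge -/

/-- the ZERO-MEAN CORRECTION of a Dirichlet scalar: `μ − E(Q′_Ω μ)` with gen 8's extension operator `E = blockExt`. [folklore] -/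
def zeroMean (μ : {x // blockReg n M S x} → ℂ) : {x // blockReg n M S x} → ℂ := μ - blockExt n M S (QOm n M S *ᵥ μ)

/-- **the correction lies in `N(Q′_Ω)`**: `Q′_Ω (zeroMean μ) = 0`. [folklore] -/
theorem QOm_zeroMean (μ : {x // blockReg n M S x} → ℂ) : QOm n M S *ᵥ zeroMean n M S μ = 0 := by
  rw [zeroMean, Matrix.mulVec_sub, QOm_blockExt, sub_self]

/-- «Q∂ = ∂₁Q′» as vectors: `∇₁ (Q′_Ω μ) = Q (∂_Ω μ)`. [cite: Balaban1984PropagatorsI, (1.55) p.27 (shape)] [folklore] -/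
theorem grad1R_QOm_mulVec (μ : {x // blockReg n M S x} → ℂ) :
    grad₁R M S *ᵥ (QOm n M S *ᵥ μ) = avgR n M S *ᵥ (gradR n M S *ᵥ μ) := by
  rw [Matrix.mulVec_mulVec, Matrix.mulVec_mulVec, avgR_mul_gradR]

/-- the energy of the correction term: `nsq (∂_Ω E(Q′_Ω μ)) ≤ Cext·n^d·nsq (Q ∂_Ω μ)`. [folklore] -/
theorem nsq_gradR_blockExt_QOm_le (hn : 2 ≤ n) (μ : {x // blockReg n M S x} → ℂ) :
    nsq (gradR n M S *ᵥ blockExt n M S (QOm n M S *ᵥ μ)) ≤ Cext d * ((n : ℝ) ^ d * nsq (avgR n M S *ᵥ (gradR n M S *ᵥ μ))) := by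
  rw [← grad1R_QOm_mulVec]
  exact nsq_gradR_blockExt_le n M S hn _

/-- `n^d·nsq (Q ∂_Ω μ) ≤ 2·n^d·nsq (QA) + 2·nsq (A − ∂_Ω μ)` (the averaging contracts). [folklore] -/
theorem nsq_avgR_gradR_le (A : {b // starReg n M S b} → ℂ) (μ : {x // blockReg n M S x} → ℂ) :
    (n : ℝ) ^ d * nsq (avgR n M S *ᵥ (gradR n M S *ᵥ μ))
      ≤ 2 * ((n : ℝ) ^ d * nsq (avgR n M S *ᵥ A)) + 2 * nsq (A - gradR n M S *ᵥ μ) := by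
  have hn : (0 : ℝ) ≤ (n : ℝ) ^ d := by positivity
  have e : avgR n M S *ᵥ (gradR n M S *ᵥ μ) = avgR n M S *ᵥ A + -(avgR n M S *ᵥ (A - gradR n M S *ᵥ μ)) := by
    rw [Matrix.mulVec_sub]; abel
  have h1 : nsq (avgR n M S *ᵥ (gradR n M S *ᵥ μ))
      ≤ 2 * nsq (avgR n M S *ᵥ A) + 2 * nsq (avgR n M S *ᵥ (A - gradR n M S *ᵥ μ)) := by
    rw [e]
    have h := nsq_add_le (avgR n M S *ᵥ A) (-(avgR n M S *ᵥ (A - gradR n M S *ᵥ μ)))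
    rwa [nsq_neg'] at h
  have h2 := nsq_avgR_le n M S (A - gradR n M S *ᵥ μ)
  nlinarith

/-- **THE CORRECTED GAUGE IS AS GOOD AS THE ORIGINAL ONE, UP TO THE MASS TERM**:
`nsq (A − ∂_Ω zeroMean μ) ≤ (2 + 4·Cext)·nsq (A − ∂_Ω μ) + 4·Cext·n^d·nsq (avgR A)` (`2 ≤ n`). [folklore] -/
theorem nsq_sub_gradR_zeroMean_le (hn : 2 ≤ n) (A : {b // starReg n M S b} → ℂ) (μ : {x // blockReg n M S x} → ℂ) :
    nsq (A - gradR n M S *ᵥ zeroMean n M S μ)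
      ≤ (2 + 4 * Cext d) * nsq (A - gradR n M S *ᵥ μ) + 4 * Cext d * ((n : ℝ) ^ d * nsq (avgR n M S *ᵥ A)) := by
  have hC := (Cext_pos d).le
  have e : A - gradR n M S *ᵥ zeroMean n M S μ = (A - gradR n M S *ᵥ μ) + gradR n M S *ᵥ blockExt n M S (QOm n M S *ᵥ μ) := by
    rw [zeroMean, Matrix.mulVec_sub]; abel
  have h1 : nsq (A - gradR n M S *ᵥ zeroMean n M S μ)
      ≤ 2 * nsq (A - gradR n M S *ᵥ μ) + 2 * nsq (gradR n M S *ᵥ blockExt n M S (QOm n M S *ᵥ μ)) := by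
    rw [e]; exact nsq_add_le _ _
  have h2 := nsq_gradR_blockExt_QOm_le n M S hn μ
  have h3 := nsq_avgR_gradR_le n M S A μ
  have h4 : nsq (gradR n M S *ᵥ blockExt n M S (QOm n M S *ᵥ μ))
      ≤ Cext d * (2 * ((n : ℝ) ^ d * nsq (avgR n M S *ᵥ A)) + 2 * nsq (A - gradR n M S *ᵥ μ)) :=
    h2.trans (mul_le_mul_of_nonneg_left h3 hC)
  nlinarith

/-! ## §3 Orbit minimality and the per-field END -/

/-- **ORBIT MINIMALITY**: a field orthogonal to the residual gauge directions `∂_Ω N(Q′_Ω)` is no longer than ANY point of its residual orbit: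
`nsq A ≤ nsq (A − ∂_Ω μ′)` for `Q′_Ω μ′ = 0` (Pythagoras). [folklore] -/
theorem nsq_le_of_orth_ker (A : {b // starReg n M S b} → ℂ)
    (horth : ∀ lam : {x // blockReg n M S x} → ℂ, QOm n M S *ᵥ lam = 0 → star (gradR n M S *ᵥ lam) ⬝ᵥ A = 0)
    (μ' : {x // blockReg n M S x} → ℂ) (hμ' : QOm n M S *ᵥ μ' = 0) : nsq A ≤ nsq (A - gradR n M S *ᵥ μ') := by
  have e : A - gradR n M S *ᵥ μ' = A + gradR n M S *ᵥ (-μ') := by rw [Matrix.mulVec_neg, sub_eq_add_neg]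
  have h0 : star (gradR n M S *ᵥ (-μ')) ⬝ᵥ A = 0 := horth _ (by rw [Matrix.mulVec_neg, hμ', neg_zero])
  rw [e, nsq_add_of_orth _ _ h0]
  have := nsq_nonneg (gradR n M S *ᵥ (-μ'))
  linarith

/-- **THE PER-FIELD END**: for `A ⊥ ∂_Ω N(Q′_Ω)` and ANY Dirichlet scalar `μ` on `Ω`,
`nsq A ≤ (2 + 4·Cext)·nsq (A − ∂_Ω μ) + 4·Cext·n^d·nsq (avgR A)` (`2 ≤ n`). [folklore] -/
theorem nsq_le_of_gauge (hn : 2 ≤ n) (A : {b // starReg n M S b} → ℂ)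
    (horth : ∀ lam : {x // blockReg n M S x} → ℂ, QOm n M S *ᵥ lam = 0 → star (gradR n M S *ᵥ lam) ⬝ᵥ A = 0)
    (μ : {x // blockReg n M S x} → ℂ) :
    nsq A ≤ (2 + 4 * Cext d) * nsq (A - gradR n M S *ᵥ μ) + 4 * Cext d * ((n : ℝ) ^ d * nsq (avgR n M S *ᵥ A)) :=
  (nsq_le_of_orth_ker n M S A horth _ (QOm_zeroMean n M S μ)).trans (nsq_sub_gradR_zeroMean_le n M S hn A μ)

/-! ## §4 The END: W1 from the orbit inequality -/

/-- the W1 constant produced by an orbit inequality with constants `C₁` (curl) and `C₂` (mass):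
`orbitConst d a C₁ C₂ = (max ((2+4Cext)C₁) (((2+4Cext)C₂ + 4Cext)/a))⁻¹`. [folklore] -/
def orbitConst (d : ℕ) (a C₁ C₂ : ℝ) : ℝ := (max ((2 + 4 * Cext d) * C₁) (((2 + 4 * Cext d) * C₂ + 4 * Cext d) / a))⁻¹

/-- `0 < orbitConst d a C₁ C₂` for `0 < a`, `0 ≤ C₂`. [folklore] -/
theorem orbitConst_pos (d : ℕ) {a C₁ C₂ : ℝ} (ha : 0 < a) (hC₂ : 0 ≤ C₂) : 0 < orbitConst d a C₁ C₂ := by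
  have hC := Cext_pos d
  unfold orbitConst
  refine inv_pos.mpr (lt_max_of_lt_right ?_)
  have : 0 < (2 + 4 * Cext d) * C₂ + 4 * Cext d := by positivity
  positivity

/-- **THE DISPLAYED W1 INEQUALITY FROM THE ORBIT INEQUALITY**: if every star-bond field admits SOME Dirichlet scalar `μ` on `Ω` with
`nsq (A − ∂_Ω μ) ≤ C₁·nsq (curlR A) + C₂·n^d·nsq (avgR A)` (`0 ≤ C₂`; no sign needed on `C₁`), then
`OrthSliceCoercive (curlR …) (gradR …) (QOm …) (avgR …) (a·n^d) (orbitConst d a C₁ C₂)` (`0 < a`, `2 ≤ n`) — «the slice can be forgotten: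
W1 is a statement about residual gauge ORBITS». [folklore] -/
theorem orthSlice_of_gaugePoincare (hn : 2 ≤ n) (ha : 0 < a) {C₁ C₂ : ℝ} (hC₂ : 0 ≤ C₂)
    (hPL : ∀ A : {b // starReg n M S b} → ℂ, ∃ μ : {x // blockReg n M S x} → ℂ,
      nsq (A - gradR n M S *ᵥ μ) ≤ C₁ * nsq (curlR n M S *ᵥ A) + C₂ * ((n : ℝ) ^ d * nsq (avgR n M S *ᵥ A))) :
    OrthSliceCoercive (curlR n M S) (gradR n M S) (QOm n M S) (avgR n M S) (a * (n : ℝ) ^ d) (orbitConst d a C₁ C₂) := by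
  intro A horth
  obtain ⟨μ, hμ⟩ := hPL A
  have hC := Cext_pos d
  set F := nsq (curlR n M S *ᵥ A) with hF
  set m := (n : ℝ) ^ d * nsq (avgR n M S *ᵥ A) with hm
  set X := nsq (A - gradR n M S *ᵥ μ) with hX
  set K := max ((2 + 4 * Cext d) * C₁) (((2 + 4 * Cext d) * C₂ + 4 * Cext d) / a) with hK
  have hF0 : 0 ≤ F := nsq_nonneg _
  have hm0 : 0 ≤ m := by have := nsq_nonneg (avgR n M S *ᵥ A); positivity
  have hK0 : 0 < K := by
    have : 0 < (2 + 4 * Cext d) * C₂ + 4 * Cext d := by positivity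
    exact lt_max_of_lt_right (by positivity)
  have h1 := nsq_le_of_gauge n M S hn A horth μ
  -- `nsq A ≤ (2+4Cext)C₁·F + ((2+4Cext)C₂ + 4Cext)·m ≤ K·F + K·(a·m)`
  have h2 : nsq A ≤ (2 + 4 * Cext d) * C₁ * F + ((2 + 4 * Cext d) * C₂ + 4 * Cext d) * m := by
    have h3 : (2 + 4 * Cext d) * X ≤ (2 + 4 * Cext d) * (C₁ * F + C₂ * m) := mul_le_mul_of_nonneg_left hμ (by positivity)
    nlinarith
  have h4 : (2 + 4 * Cext d) * C₁ * F ≤ K * F := mul_le_mul_of_nonneg_right (le_max_left _ _) hF0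
  have h5 : ((2 + 4 * Cext d) * C₂ + 4 * Cext d) * m ≤ K * (a * m) := by
    have e : ((2 + 4 * Cext d) * C₂ + 4 * Cext d) * m = (((2 + 4 * Cext d) * C₂ + 4 * Cext d) / a) * (a * m) := by
      field_simp
    rw [e]
    exact mul_le_mul_of_nonneg_right (le_max_right _ _) (by positivity)
  have h6 : nsq A ≤ K * (F + a * m) := by nlinarith
  have e7 : orbitConst d a C₁ C₂ = K⁻¹ := rfl
  rw [e7]
  calc K⁻¹ * nsq A ≤ K⁻¹ * (K * (F + a * m)) := mul_le_mul_of_nonneg_left h6 (inv_nonneg.mpr hK0.le)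
    _ = F + a * m := by rw [← mul_assoc, inv_mul_cancel₀ hK0.ne', one_mul]
    _ = F + a * (n : ℝ) ^ d * nsq (avgR n M S *ᵥ A) := by rw [hm, mul_assoc]

/-! ## §5 The converse: W1 gives the orbit inequality (with a zero-mean gauge) -/

/-- **THE CONVERSE**: `OrthSliceCoercive … c` (`0 < a′` for the region's scalar Green's function used by gen 8's orthogonal representative)
⟹ every `A` admits a Dirichlet scalar `μ ∈ N(Q′_Ω)` with `c·nsq (A − ∂_Ω μ) ≤ nsq (curlR A) + a n^d·nsq (avgR A)` (μ = `orthGauge`).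
So W1 ⟺ the orbit inequality, up to the constants of §4. [folklore] -/
theorem gaugePoincare_of_orthSlice (ha' : 0 < a') {c : ℝ}
    (hO : OrthSliceCoercive (curlR n M S) (gradR n M S) (QOm n M S) (avgR n M S) (a * (n : ℝ) ^ d) c)
    (A : {b // starReg n M S b} → ℂ) :
    ∃ μ : {x // blockReg n M S x} → ℂ, QOm n M S *ᵥ μ = 0 ∧
      c * nsq (A - gradR n M S *ᵥ μ) ≤ nsq (curlR n M S *ᵥ A) + a * (n : ℝ) ^ d * nsq (avgR n M S *ᵥ A) := by
  have h := sliceData_region n M a' S ha'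
  have hθ : (0 : ℝ) < ((n : ℝ) ^ d)⁻¹ := inv_pos.mpr (pow_pos (by exact_mod_cast Nat.pos_of_ne_zero (NeZero.ne n)) d)
  have hS := isUnit_det_gramS (G := GOm n M a' S) (QOm_mul_conjTranspose n M S) hθ (sigma0_pos ha') (coercive_GOm_const n M a' S ha')
  refine ⟨orthGauge (gradR n M S) (GOm n M a' S) (QOm n M S) A, Qs_orthGauge hS A, ?_⟩
  have key := hO (orthPart (gradR n M S) (GOm n M a' S) (QOm n M S) A) (orth_orthPart h hS A)
  rw [Cu_orthPart h A, Qv_orthPart h hS A] at key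
  exact key

end Summit.QuantumFields.BalabanUV.T4Continuum.RegionGaugeOrbit

end
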